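import Mathlib
import HarnessLib
import Summits.Ventures.LatticeQCDFlow.Exactness.SU2WilsonFlowLOLocality
import Summits.Ventures.LatticeQCDFlow.Exactness.LatticeForceVolumeUniform

/-!
# THE TRANSPLANT: the exact force through the `SU(2)` LO Wilson-flow member at a link of the `L`-torus EQUALS the force on a FIXED reference torus `L₁` at a window-transplanted field — for EVERY volume `L`

HONEST FRAMING: exact (Metropolis-corrected) sampling algorithms for lattice gauge theory;
figures of merit are autocorrelation/cost numbers at stated couplings and volumes; no
continuum-physics claim.

Venture `LatticeQCDFlow` (cell pub-lqcd), topic `Exactness`; FANOUT row 14 (`eng-flowhmc`, engine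
`latflow.fthmc`, family B: FT-HMC through the LO Wilson-flow member on `SU(2)`, forces by autodiff of
`S̃ = β S_W∘F − log J` along row 9's Pauli drift).  NEW WORK of the cell over the tree
(`SU2ExactForceCovering`: the covering identity `Φ'(V∘σ̂)_{e'} = Φ(V)_{σ̂ e'}`;
`SU2WilsonFlowLOLocality`: the force at `l₀` reads the `(2K+2)`-ball at `l₀.1` only;
`LatticeForceVolumeUniform`: the window transplant and `transplant_agree`;
`LatticeCoveringPullback` / `GaugeFieldLocality`: site maps and neighbourhoods; Mathlib's
`ZMod.castHom`, `ZMod.valMinAbs`); nothing is cited as a fact; no number.  Eighth file of the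
VOLUME-UNIFORMITY chain (GEN-15).

THE POINT.  Fix the schedule (hence `K` and `R = 2K+2`) and a reference side `L₁ > 2R`.  For ANY side
`L`, any field `V` on the `L`-torus and any link `l = (c, μ)`: go UP to the `(L·L₁)`-torus along the
covering `π₁ : ℤ/(L L₁) → ℤ/L` (the force of `V∘π₁` at the lift `(ĉ, μ)`, `ĉᵢ = val(cᵢ)`, is the force of
`V` at `l` — covering identity); there, `V∘π₁` agrees on the `R`-ball at `ĉ` with `V♭∘π₂`, where
`π₂ : ℤ/(L L₁) → ℤ/L₁` and the TRANSPLANT `V♭` on the `L₁`-torus copies the window: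
`V♭(y, ν) = V(c + valMinAbs(y − c₁), ν)` if every `|valMinAbs(yᵢ − c₁ᵢ)| ≤ R` (`c₁ᵢ = val(cᵢ) mod L₁`),
`= 1` otherwise (`valMinAbs` recovers the representative because `2R < L₁`); so by LOCALITY the two
forces at `(ĉ, μ)` coincide; go DOWN along `π₂` (covering identity again).  Net:
`Φ^L(V)_{(c,μ)} = Φ^{L₁}(V♭)_{(c₁,μ)}` — the right-hand side lives on ONE torus for all `L`.

* (from `LatticeForceVolumeUniform`: `transplant_agree` — on the `(L·L₁)`-torus `V∘π̂₁` and `V♭∘π̂₂`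
  agree on the `R`-ball at the lift `ĉ`; the group-agnostic VOLUME-UNIFORMITY PRINCIPLE lives there);
* `norm_transplant_sub_le` — the transplant is `1`-Lipschitz in the matrix sup norm
  (`‖coeConfig V♭ − coeConfig V'♭‖ ≤ ‖coeConfig V − coeConfig V'‖`);
* **`su2WilsonFlowLO_exactForce_transplant`** — colourings `χ` (side `L`), `χ₁` (side `L₁`) admitting a
  common refinement `χ̂` on the `(L·L₁)`-torus (`χ̂ = χ∘π₁ = χ₁∘π₂`; phase masks of a width dividing
  `L` and `L₁` do), layers on the three tori packaged VERBATIM as in `exists_layers_su2WilsonFlowLO`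
  (positive densities on the big torus), `2(2K+2) < L₁`, every `β, κ, V, l`:
  `Φ^L_κ(V)_l = Φ^{L₁}_κ(V♭)_{(c₁, l.2)}`.

NOT CLAIMED: anything for colourings without a common refinement on the product torus; the learned
residual members; any number.
-/

noncomputable section

namespace Summit.Ventures.LatticeQCDFlow.Exactness

open Real Set MeasureTheory InnerProductGeometry WithLp NormedSpace
open Literature.MathematicalPhysics.QuantumFieldTheory
open Literature.MathematicalPhysics.QuantumFieldTheory.Balaban1983to89.B10Eq18SigmaSU2Haar (expPauli)
open scoped Matrix Matrix.Norms.Operator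

set_option backward.isDefEq.respectTransparency false

/-! ## §1 The window transplant -/

section Transplant

variable {d L L₁ : ℕ} [NeZero L] [NeZero L₁]

/-- **The transplant is `1`-Lipschitz in the matrix sup norm**: every link of `V♭` is a link of `V` or
the constant `1`. -/
theorem norm_transplant_sub_le (c : Site d L) (R : ℕ) (V V' : GaugeConfig d L (Matrix.specialUnitaryGroup (Fin 2) ℂ)) :
    ‖coeConfig (fun e₁ : Edge d L₁ => if (∀ i, |ZMod.valMinAbs (e₁.1 i - (((c i).val : ℕ) : ZMod L₁))| ≤ ((R : ℕ) : ℤ)) then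
        V (fun i => c i + ((ZMod.valMinAbs (e₁.1 i - (((c i).val : ℕ) : ZMod L₁)) : ℤ) : ZMod L), e₁.2) else 1) -
        coeConfig (fun e₁ : Edge d L₁ => if (∀ i, |ZMod.valMinAbs (e₁.1 i - (((c i).val : ℕ) : ZMod L₁))| ≤ ((R : ℕ) : ℤ)) then
        V' (fun i => c i + ((ZMod.valMinAbs (e₁.1 i - (((c i).val : ℕ) : ZMod L₁)) : ℤ) : ZMod L), e₁.2) else 1)‖ ≤
      ‖coeConfig V - coeConfig V'‖ := by
  refine pi_norm_le_iff_of_nonneg (norm_nonneg _) |>.2 fun e₁ => ?_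
  simp only [Pi.sub_apply, coeConfig_apply]
  split_ifs with h
  · exact norm_le_pi_norm (coeConfig V - coeConfig V') _
  · simp

end Transplant

/-! ## §2 The force at a link of the `L`-torus is the force on the reference torus -/

section Force

variable {d L L₁ : ℕ} [NeZero L] [NeZero L₁] {X : Type*} [DecidableEq X]
  (χ : Site d L → X) (χ₁ : Site d L₁ → X) (χM : Site d (L*L₁) → X)

/-- **THE TRANSPLANT IDENTITY FOR THE EXACT FORCE.**  Colourings `χ` (side `L`), `χ₁` (side `L₁`) with
a common refinement `χ̂` on the `(L·L₁)`-torus, ANY schedule `sched` (`K = sched.length`,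
`R = 2K+2`, `2R < L₁`), layers on the three tori packaged VERBATIM as in
`exists_layers_su2WilsonFlowLO` (positive booked densities on the big torus), every `β, κ`, every
field `V` and link `l` of the `L`-torus: `Φ^L_κ(V)_l = Φ^{L₁}_κ(V♭)_{(c₁, l.2)}` with `c = l.1`,
`c₁ = (val cᵢ mod L₁)ᵢ` and the window transplant `V♭` of radius `R` centred at `c`. -/
theorem su2WilsonFlowLO_exactForce_transplant
    (hχ1 : ∀ x : Site d (L*L₁), χM x = χ (fun j => (ZMod.castHom (dvd_mul_right L L₁) (ZMod L)) (x j)))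
    (hχ2 : ∀ x : Site d (L*L₁), χM x = χ₁ (fun j => (ZMod.castHom (dvd_mul_left L₁ L) (ZMod L₁)) (x j)))
    (ε : ℝ) (sched : List (Fin d × X))
    (layers : List ((GaugeConfig d L (Matrix.specialUnitaryGroup (Fin 2) ℂ) ≃ᵐ GaugeConfig d L (Matrix.specialUnitaryGroup (Fin 2) ℂ)) × (GaugeConfig d L (Matrix.specialUnitaryGroup (Fin 2) ℂ) → ℝ)))
    (layers₁ : List ((GaugeConfig d L₁ (Matrix.specialUnitaryGroup (Fin 2) ℂ) ≃ᵐ GaugeConfig d L₁ (Matrix.specialUnitaryGroup (Fin 2) ℂ)) × (GaugeConfig d L₁ (Matrix.specialUnitaryGroup (Fin 2) ℂ) → ℝ)))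
    (layersM : List ((GaugeConfig d (L*L₁) (Matrix.specialUnitaryGroup (Fin 2) ℂ) ≃ᵐ GaugeConfig d (L*L₁) (Matrix.specialUnitaryGroup (Fin 2) ℂ)) × (GaugeConfig d (L*L₁) (Matrix.specialUnitaryGroup (Fin 2) ℂ) → ℝ)))
    (hmap :
      layers.map (fun Ly => ((Ly.1 : GaugeConfig d L (Matrix.specialUnitaryGroup (Fin 2) ℂ) → GaugeConfig d L (Matrix.specialUnitaryGroup (Fin 2) ℂ)), Ly.2)) =
        sched.map (fun s =>
        ((fun (V : GaugeConfig d L (Matrix.specialUnitaryGroup (Fin 2) ℂ)) (e : Edge d L) =>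
        if e.2 = s.1 ∧ χ e.1 = s.2 then
          gaussUnit (geodesicKick ε (∑ ν ∈ Finset.univ.erase e.2,
            (vecQuat (((V (Site.shift e.1 e.2, ν) * (V (Site.shift e.1 ν, e.2))⁻¹ * (V (e.1, ν))⁻¹)⁻¹ : (Matrix.specialUnitaryGroup (Fin 2) ℂ)) : Matrix (Fin 2) (Fin 2) ℂ) +
              vecQuat ((((V (Site.shift (e.1 - Pi.single ν 1) e.2, ν))⁻¹ * (V (e.1 - Pi.single ν 1, e.2))⁻¹ *
                V (e.1 - Pi.single ν 1, ν))⁻¹ : (Matrix.specialUnitaryGroup (Fin 2) ℂ)) : Matrix (Fin 2) (Fin 2) ℂ)))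
            (vecQuat ((V e : (Matrix.specialUnitaryGroup (Fin 2) ℂ)) : Matrix (Fin 2) (Fin 2) ℂ)))
        else V e),
         fun V : GaugeConfig d L (Matrix.specialUnitaryGroup (Fin 2) ℂ) => ∏ a : {e : Edge d L // e.2 = s.1 ∧ χ e.1 = s.2},
          (if Real.sin (angle (∑ ν ∈ Finset.univ.erase a.1.2,
            (vecQuat (((V (Site.shift a.1.1 a.1.2, ν) * (V (Site.shift a.1.1 ν, a.1.2))⁻¹ * (V (a.1.1, ν))⁻¹)⁻¹ : (Matrix.specialUnitaryGroup (Fin 2) ℂ)) : Matrix (Fin 2) (Fin 2) ℂ) +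
              vecQuat ((((V (Site.shift (a.1.1 - Pi.single ν 1) a.1.2, ν))⁻¹ * (V (a.1.1 - Pi.single ν 1, a.1.2))⁻¹ *
                V (a.1.1 - Pi.single ν 1, ν))⁻¹ : (Matrix.specialUnitaryGroup (Fin 2) ℂ)) : Matrix (Fin 2) (Fin 2) ℂ))) (vecQuat ((V a.1 : (Matrix.specialUnitaryGroup (Fin 2) ℂ)) : Matrix (Fin 2) (Fin 2) ℂ))) = 0 then
            (1 - ε * ‖(∑ ν ∈ Finset.univ.erase a.1.2,
            (vecQuat (((V (Site.shift a.1.1 a.1.2, ν) * (V (Site.shift a.1.1 ν, a.1.2))⁻¹ * (V (a.1.1, ν))⁻¹)⁻¹ : (Matrix.specialUnitaryGroup (Fin 2) ℂ)) : Matrix (Fin 2) (Fin 2) ℂ) +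
              vecQuat ((((V (Site.shift (a.1.1 - Pi.single ν 1) a.1.2, ν))⁻¹ * (V (a.1.1 - Pi.single ν 1, a.1.2))⁻¹ *
                V (a.1.1 - Pi.single ν 1, ν))⁻¹ : (Matrix.specialUnitaryGroup (Fin 2) ℂ)) : Matrix (Fin 2) (Fin 2) ℂ)))‖ * Real.cos (angle (∑ ν ∈ Finset.univ.erase a.1.2,
            (vecQuat (((V (Site.shift a.1.1 a.1.2, ν) * (V (Site.shift a.1.1 ν, a.1.2))⁻¹ * (V (a.1.1, ν))⁻¹)⁻¹ : (Matrix.specialUnitaryGroup (Fin 2) ℂ)) : Matrix (Fin 2) (Fin 2) ℂ) +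
              vecQuat ((((V (Site.shift (a.1.1 - Pi.single ν 1) a.1.2, ν))⁻¹ * (V (a.1.1 - Pi.single ν 1, a.1.2))⁻¹ *
                V (a.1.1 - Pi.single ν 1, ν))⁻¹ : (Matrix.specialUnitaryGroup (Fin 2) ℂ)) : Matrix (Fin 2) (Fin 2) ℂ))) (vecQuat ((V a.1 : (Matrix.specialUnitaryGroup (Fin 2) ℂ)) : Matrix (Fin 2) (Fin 2) ℂ)))) ^ 3
          else kickJac (ε * ‖(∑ ν ∈ Finset.univ.erase a.1.2,
            (vecQuat (((V (Site.shift a.1.1 a.1.2, ν) * (V (Site.shift a.1.1 ν, a.1.2))⁻¹ * (V (a.1.1, ν))⁻¹)⁻¹ : (Matrix.specialUnitaryGroup (Fin 2) ℂ)) : Matrix (Fin 2) (Fin 2) ℂ) +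
              vecQuat ((((V (Site.shift (a.1.1 - Pi.single ν 1) a.1.2, ν))⁻¹ * (V (a.1.1 - Pi.single ν 1, a.1.2))⁻¹ *
                V (a.1.1 - Pi.single ν 1, ν))⁻¹ : (Matrix.specialUnitaryGroup (Fin 2) ℂ)) : Matrix (Fin 2) (Fin 2) ℂ)))‖) 2 (angle (∑ ν ∈ Finset.univ.erase a.1.2,
            (vecQuat (((V (Site.shift a.1.1 a.1.2, ν) * (V (Site.shift a.1.1 ν, a.1.2))⁻¹ * (V (a.1.1, ν))⁻¹)⁻¹ : (Matrix.specialUnitaryGroup (Fin 2) ℂ)) : Matrix (Fin 2) (Fin 2) ℂ) +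
              vecQuat ((((V (Site.shift (a.1.1 - Pi.single ν 1) a.1.2, ν))⁻¹ * (V (a.1.1 - Pi.single ν 1, a.1.2))⁻¹ *
                V (a.1.1 - Pi.single ν 1, ν))⁻¹ : (Matrix.specialUnitaryGroup (Fin 2) ℂ)) : Matrix (Fin 2) (Fin 2) ℂ))) (vecQuat ((V a.1 : (Matrix.specialUnitaryGroup (Fin 2) ℂ)) : Matrix (Fin 2) (Fin 2) ℂ)))))))
    (hmap₁ :
      layers₁.map (fun Ly => ((Ly.1 : GaugeConfig d L₁ (Matrix.specialUnitaryGroup (Fin 2) ℂ) → GaugeConfig d L₁ (Matrix.specialUnitaryGroup (Fin 2) ℂ)), Ly.2)) =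
        sched.map (fun s =>
        ((fun (V : GaugeConfig d L₁ (Matrix.specialUnitaryGroup (Fin 2) ℂ)) (e : Edge d L₁) =>
        if e.2 = s.1 ∧ χ₁ e.1 = s.2 then
          gaussUnit (geodesicKick ε (∑ ν ∈ Finset.univ.erase e.2,
            (vecQuat (((V (Site.shift e.1 e.2, ν) * (V (Site.shift e.1 ν, e.2))⁻¹ * (V (e.1, ν))⁻¹)⁻¹ : (Matrix.specialUnitaryGroup (Fin 2) ℂ)) : Matrix (Fin 2) (Fin 2) ℂ) +
              vecQuat ((((V (Site.shift (e.1 - Pi.single ν 1) e.2, ν))⁻¹ * (V (e.1 - Pi.single ν 1, e.2))⁻¹ *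
                V (e.1 - Pi.single ν 1, ν))⁻¹ : (Matrix.specialUnitaryGroup (Fin 2) ℂ)) : Matrix (Fin 2) (Fin 2) ℂ)))
            (vecQuat ((V e : (Matrix.specialUnitaryGroup (Fin 2) ℂ)) : Matrix (Fin 2) (Fin 2) ℂ)))
        else V e),
         fun V : GaugeConfig d L₁ (Matrix.specialUnitaryGroup (Fin 2) ℂ) => ∏ a : {e : Edge d L₁ // e.2 = s.1 ∧ χ₁ e.1 = s.2},
          (if Real.sin (angle (∑ ν ∈ Finset.univ.erase a.1.2,
            (vecQuat (((V (Site.shift a.1.1 a.1.2, ν) * (V (Site.shift a.1.1 ν, a.1.2))⁻¹ * (V (a.1.1, ν))⁻¹)⁻¹ : (Matrix.specialUnitaryGroup (Fin 2) ℂ)) : Matrix (Fin 2) (Fin 2) ℂ) +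
              vecQuat ((((V (Site.shift (a.1.1 - Pi.single ν 1) a.1.2, ν))⁻¹ * (V (a.1.1 - Pi.single ν 1, a.1.2))⁻¹ *
                V (a.1.1 - Pi.single ν 1, ν))⁻¹ : (Matrix.specialUnitaryGroup (Fin 2) ℂ)) : Matrix (Fin 2) (Fin 2) ℂ))) (vecQuat ((V a.1 : (Matrix.specialUnitaryGroup (Fin 2) ℂ)) : Matrix (Fin 2) (Fin 2) ℂ))) = 0 then
            (1 - ε * ‖(∑ ν ∈ Finset.univ.erase a.1.2,
            (vecQuat (((V (Site.shift a.1.1 a.1.2, ν) * (V (Site.shift a.1.1 ν, a.1.2))⁻¹ * (V (a.1.1, ν))⁻¹)⁻¹ : (Matrix.specialUnitaryGroup (Fin 2) ℂ)) : Matrix (Fin 2) (Fin 2) ℂ) +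
              vecQuat ((((V (Site.shift (a.1.1 - Pi.single ν 1) a.1.2, ν))⁻¹ * (V (a.1.1 - Pi.single ν 1, a.1.2))⁻¹ *
                V (a.1.1 - Pi.single ν 1, ν))⁻¹ : (Matrix.specialUnitaryGroup (Fin 2) ℂ)) : Matrix (Fin 2) (Fin 2) ℂ)))‖ * Real.cos (angle (∑ ν ∈ Finset.univ.erase a.1.2,
            (vecQuat (((V (Site.shift a.1.1 a.1.2, ν) * (V (Site.shift a.1.1 ν, a.1.2))⁻¹ * (V (a.1.1, ν))⁻¹)⁻¹ : (Matrix.specialUnitaryGroup (Fin 2) ℂ)) : Matrix (Fin 2) (Fin 2) ℂ) +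
              vecQuat ((((V (Site.shift (a.1.1 - Pi.single ν 1) a.1.2, ν))⁻¹ * (V (a.1.1 - Pi.single ν 1, a.1.2))⁻¹ *
                V (a.1.1 - Pi.single ν 1, ν))⁻¹ : (Matrix.specialUnitaryGroup (Fin 2) ℂ)) : Matrix (Fin 2) (Fin 2) ℂ))) (vecQuat ((V a.1 : (Matrix.specialUnitaryGroup (Fin 2) ℂ)) : Matrix (Fin 2) (Fin 2) ℂ)))) ^ 3
          else kickJac (ε * ‖(∑ ν ∈ Finset.univ.erase a.1.2,
            (vecQuat (((V (Site.shift a.1.1 a.1.2, ν) * (V (Site.shift a.1.1 ν, a.1.2))⁻¹ * (V (a.1.1, ν))⁻¹)⁻¹ : (Matrix.specialUnitaryGroup (Fin 2) ℂ)) : Matrix (Fin 2) (Fin 2) ℂ) +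
              vecQuat ((((V (Site.shift (a.1.1 - Pi.single ν 1) a.1.2, ν))⁻¹ * (V (a.1.1 - Pi.single ν 1, a.1.2))⁻¹ *
                V (a.1.1 - Pi.single ν 1, ν))⁻¹ : (Matrix.specialUnitaryGroup (Fin 2) ℂ)) : Matrix (Fin 2) (Fin 2) ℂ)))‖) 2 (angle (∑ ν ∈ Finset.univ.erase a.1.2,
            (vecQuat (((V (Site.shift a.1.1 a.1.2, ν) * (V (Site.shift a.1.1 ν, a.1.2))⁻¹ * (V (a.1.1, ν))⁻¹)⁻¹ : (Matrix.specialUnitaryGroup (Fin 2) ℂ)) : Matrix (Fin 2) (Fin 2) ℂ) +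
              vecQuat ((((V (Site.shift (a.1.1 - Pi.single ν 1) a.1.2, ν))⁻¹ * (V (a.1.1 - Pi.single ν 1, a.1.2))⁻¹ *
                V (a.1.1 - Pi.single ν 1, ν))⁻¹ : (Matrix.specialUnitaryGroup (Fin 2) ℂ)) : Matrix (Fin 2) (Fin 2) ℂ))) (vecQuat ((V a.1 : (Matrix.specialUnitaryGroup (Fin 2) ℂ)) : Matrix (Fin 2) (Fin 2) ℂ)))))))
    (hmapM :
      layersM.map (fun Ly => ((Ly.1 : GaugeConfig d (L*L₁) (Matrix.specialUnitaryGroup (Fin 2) ℂ) → GaugeConfig d (L*L₁) (Matrix.specialUnitaryGroup (Fin 2) ℂ)), Ly.2)) =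
        sched.map (fun s =>
        ((fun (V : GaugeConfig d (L*L₁) (Matrix.specialUnitaryGroup (Fin 2) ℂ)) (e : Edge d (L*L₁)) =>
        if e.2 = s.1 ∧ χM e.1 = s.2 then
          gaussUnit (geodesicKick ε (∑ ν ∈ Finset.univ.erase e.2,
            (vecQuat (((V (Site.shift e.1 e.2, ν) * (V (Site.shift e.1 ν, e.2))⁻¹ * (V (e.1, ν))⁻¹)⁻¹ : (Matrix.specialUnitaryGroup (Fin 2) ℂ)) : Matrix (Fin 2) (Fin 2) ℂ) +
              vecQuat ((((V (Site.shift (e.1 - Pi.single ν 1) e.2, ν))⁻¹ * (V (e.1 - Pi.single ν 1, e.2))⁻¹ *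
                V (e.1 - Pi.single ν 1, ν))⁻¹ : (Matrix.specialUnitaryGroup (Fin 2) ℂ)) : Matrix (Fin 2) (Fin 2) ℂ)))
            (vecQuat ((V e : (Matrix.specialUnitaryGroup (Fin 2) ℂ)) : Matrix (Fin 2) (Fin 2) ℂ)))
        else V e),
         fun V : GaugeConfig d (L*L₁) (Matrix.specialUnitaryGroup (Fin 2) ℂ) => ∏ a : {e : Edge d (L*L₁) // e.2 = s.1 ∧ χM e.1 = s.2},
          (if Real.sin (angle (∑ ν ∈ Finset.univ.erase a.1.2,
            (vecQuat (((V (Site.shift a.1.1 a.1.2, ν) * (V (Site.shift a.1.1 ν, a.1.2))⁻¹ * (V (a.1.1, ν))⁻¹)⁻¹ : (Matrix.specialUnitaryGroup (Fin 2) ℂ)) : Matrix (Fin 2) (Fin 2) ℂ) +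
              vecQuat ((((V (Site.shift (a.1.1 - Pi.single ν 1) a.1.2, ν))⁻¹ * (V (a.1.1 - Pi.single ν 1, a.1.2))⁻¹ *
                V (a.1.1 - Pi.single ν 1, ν))⁻¹ : (Matrix.specialUnitaryGroup (Fin 2) ℂ)) : Matrix (Fin 2) (Fin 2) ℂ))) (vecQuat ((V a.1 : (Matrix.specialUnitaryGroup (Fin 2) ℂ)) : Matrix (Fin 2) (Fin 2) ℂ))) = 0 then
            (1 - ε * ‖(∑ ν ∈ Finset.univ.erase a.1.2,
            (vecQuat (((V (Site.shift a.1.1 a.1.2, ν) * (V (Site.shift a.1.1 ν, a.1.2))⁻¹ * (V (a.1.1, ν))⁻¹)⁻¹ : (Matrix.specialUnitaryGroup (Fin 2) ℂ)) : Matrix (Fin 2) (Fin 2) ℂ) +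
              vecQuat ((((V (Site.shift (a.1.1 - Pi.single ν 1) a.1.2, ν))⁻¹ * (V (a.1.1 - Pi.single ν 1, a.1.2))⁻¹ *
                V (a.1.1 - Pi.single ν 1, ν))⁻¹ : (Matrix.specialUnitaryGroup (Fin 2) ℂ)) : Matrix (Fin 2) (Fin 2) ℂ)))‖ * Real.cos (angle (∑ ν ∈ Finset.univ.erase a.1.2,
            (vecQuat (((V (Site.shift a.1.1 a.1.2, ν) * (V (Site.shift a.1.1 ν, a.1.2))⁻¹ * (V (a.1.1, ν))⁻¹)⁻¹ : (Matrix.specialUnitaryGroup (Fin 2) ℂ)) : Matrix (Fin 2) (Fin 2) ℂ) +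
              vecQuat ((((V (Site.shift (a.1.1 - Pi.single ν 1) a.1.2, ν))⁻¹ * (V (a.1.1 - Pi.single ν 1, a.1.2))⁻¹ *
                V (a.1.1 - Pi.single ν 1, ν))⁻¹ : (Matrix.specialUnitaryGroup (Fin 2) ℂ)) : Matrix (Fin 2) (Fin 2) ℂ))) (vecQuat ((V a.1 : (Matrix.specialUnitaryGroup (Fin 2) ℂ)) : Matrix (Fin 2) (Fin 2) ℂ)))) ^ 3
          else kickJac (ε * ‖(∑ ν ∈ Finset.univ.erase a.1.2,
            (vecQuat (((V (Site.shift a.1.1 a.1.2, ν) * (V (Site.shift a.1.1 ν, a.1.2))⁻¹ * (V (a.1.1, ν))⁻¹)⁻¹ : (Matrix.specialUnitaryGroup (Fin 2) ℂ)) : Matrix (Fin 2) (Fin 2) ℂ) +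
              vecQuat ((((V (Site.shift (a.1.1 - Pi.single ν 1) a.1.2, ν))⁻¹ * (V (a.1.1 - Pi.single ν 1, a.1.2))⁻¹ *
                V (a.1.1 - Pi.single ν 1, ν))⁻¹ : (Matrix.specialUnitaryGroup (Fin 2) ℂ)) : Matrix (Fin 2) (Fin 2) ℂ)))‖) 2 (angle (∑ ν ∈ Finset.univ.erase a.1.2,
            (vecQuat (((V (Site.shift a.1.1 a.1.2, ν) * (V (Site.shift a.1.1 ν, a.1.2))⁻¹ * (V (a.1.1, ν))⁻¹)⁻¹ : (Matrix.specialUnitaryGroup (Fin 2) ℂ)) : Matrix (Fin 2) (Fin 2) ℂ) +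
              vecQuat ((((V (Site.shift (a.1.1 - Pi.single ν 1) a.1.2, ν))⁻¹ * (V (a.1.1 - Pi.single ν 1, a.1.2))⁻¹ *
                V (a.1.1 - Pi.single ν 1, ν))⁻¹ : (Matrix.specialUnitaryGroup (Fin 2) ℂ)) : Matrix (Fin 2) (Fin 2) ℂ))) (vecQuat ((V a.1 : (Matrix.specialUnitaryGroup (Fin 2) ℂ)) : Matrix (Fin 2) (Fin 2) ℂ)))))))
    (hposM : ∀ Ly ∈ layersM, ∀ V, 0 < Ly.2 V) (hR : 2 * (0 + 2 * sched.length + 2) < L₁) (β κ : ℝ)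
    (V : GaugeConfig d L (Matrix.specialUnitaryGroup (Fin 2) ℂ)) (l : Edge d L) (c : Site d L) (hc : c = l.1) :
    (fun (V : GaugeConfig d L (Matrix.specialUnitaryGroup (Fin 2) ℂ)) (l : Edge d L) => κ • WithLp.toLp 2 (fun i : Fin 3 =>
        fderiv ℝ (fun a : Edge d L → EuclideanSpace ℝ (Fin 3) => β * wilsonAction (Matrix.specialUnitaryGroup (Fin 2) ℂ).subtype ((layers.foldr (fun Ly (F : GaugeConfig d L (Matrix.specialUnitaryGroup (Fin 2) ℂ) ≃ᵐ GaugeConfig d L (Matrix.specialUnitaryGroup (Fin 2) ℂ)) => Ly.1.trans F) (MeasurableEquiv.refl (GaugeConfig d L (Matrix.specialUnitaryGroup (Fin 2) ℂ)))) ((fun l : Edge d L => expPauli (a l)) * V)) - Real.log ((layers.foldr (fun Ly K => fun v => Ly.2 v * K (Ly.1 v)) (fun _ => (1 : ℝ))) ((fun l : Edge d L => expPauli (a l)) * V))) 0 (Pi.single l (EuclideanSpace.single i (1 : ℝ))))) V l =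
      (fun (V : GaugeConfig d L₁ (Matrix.specialUnitaryGroup (Fin 2) ℂ)) (l : Edge d L₁) => κ • WithLp.toLp 2 (fun i : Fin 3 =>
        fderiv ℝ (fun a : Edge d L₁ → EuclideanSpace ℝ (Fin 3) => β * wilsonAction (Matrix.specialUnitaryGroup (Fin 2) ℂ).subtype ((layers₁.foldr (fun Ly (F : GaugeConfig d L₁ (Matrix.specialUnitaryGroup (Fin 2) ℂ) ≃ᵐ GaugeConfig d L₁ (Matrix.specialUnitaryGroup (Fin 2) ℂ)) => Ly.1.trans F) (MeasurableEquiv.refl (GaugeConfig d L₁ (Matrix.specialUnitaryGroup (Fin 2) ℂ)))) ((fun l : Edge d L₁ => expPauli (a l)) * V)) - Real.log ((layers₁.foldr (fun Ly K => fun v => Ly.2 v * K (Ly.1 v)) (fun _ => (1 : ℝ))) ((fun l : Edge d L₁ => expPauli (a l)) * V))) 0 (Pi.single l (EuclideanSpace.single i (1 : ℝ))))) (fun e₁ : Edge d L₁ => if (∀ i, |ZMod.valMinAbs (e₁.1 i - (((c i).val : ℕ) : ZMod L₁))| ≤ (((0+2*sched.length+2) : ℕ) : ℤ)) then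
        V (fun i => c i + ((ZMod.valMinAbs (e₁.1 i - (((c i).val : ℕ) : ZMod L₁)) : ℤ) : ZMod L), e₁.2) else 1)
        ((fun i => (((c i).val : ℕ) : ZMod L₁)), l.2) := by
  subst hc
  -- the lift of the base point and the transplanted field
  set W : GaugeConfig d L₁ (Matrix.specialUnitaryGroup (Fin 2) ℂ) := (fun e₁ : Edge d L₁ => if (∀ i, |ZMod.valMinAbs (e₁.1 i - (((l.1 i).val : ℕ) : ZMod L₁))| ≤ (((0+2*sched.length+2) : ℕ) : ℤ)) then
        V (fun i => l.1 i + ((ZMod.valMinAbs (e₁.1 i - (((l.1 i).val : ℕ) : ZMod L₁)) : ℤ) : ZMod L), e₁.2) else 1) with hW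
  have hsurj₁ : Function.Surjective (ZMod.castHom (dvd_mul_right L L₁) (ZMod L)) := ZMod.castHom_surjective _
  have hsurj₂ : Function.Surjective (ZMod.castHom (dvd_mul_left L₁ L) (ZMod L₁)) := ZMod.castHom_surjective _
  have hcE : ((fun j => (ZMod.castHom (dvd_mul_right L L₁) (ZMod L)) ((fun i => (((l.1 i).val : ℕ) : ZMod (L*L₁))) j)), l.2) = l :=
    Prod.ext (funext fun j => by simp only [map_natCast, ZMod.natCast_zmod_val]) rfl
  have hcE₁ : ((fun j => (ZMod.castHom (dvd_mul_left L₁ L) (ZMod L₁)) ((fun i => (((l.1 i).val : ℕ) : ZMod (L*L₁))) j)), l.2) = ((fun i => (((l.1 i).val : ℕ) : ZMod L₁)), l.2) :=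
    Prod.ext (funext fun j => by simp only [map_natCast]) rfl
  -- UP: covering identity along π₁
  have step1 := su2WilsonFlowLO_exactForce_pull (ZMod.castHom (dvd_mul_right L L₁) (ZMod L)) χ χM hχ1 hsurj₁ ε sched layers layersM hmap hmapM hposM β κ V
    ((fun i => (((l.1 i).val : ℕ) : ZMod (L*L₁))), l.2)
  rw [hcE] at step1
  -- ACROSS: locality on the big torus
  have hT := transplant_agree (L := L) (L₁ := L₁) l.1 hR V
  rw [← hW] at hT
  have step2 := su2WilsonFlowLO_exactForce_local χM ε sched layersM hmapM hposM β κ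
    (l₀ := (((fun i => (((l.1 i).val : ℕ) : ZMod (L*L₁))) : Site d (L*L₁)), l.2)) hT
  -- DOWN: covering identity along π₂
  have step3 := su2WilsonFlowLO_exactForce_pull (ZMod.castHom (dvd_mul_left L₁ L) (ZMod L₁)) χ₁ χM hχ2 hsurj₂ ε sched layers₁ layersM hmap₁ hmapM hposM β κ W
    ((fun i => (((l.1 i).val : ℕ) : ZMod (L*L₁))), l.2)
  rw [hcE₁] at step3
  rw [← step1, step2, step3]

end Force

end Summit.Ventures.LatticeQCDFlow.Exactness
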